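import Mathlib
import Summits.FinalStateConjecture.FinalStateConjecture.Theorems.PhotonSphereChannelsRWPotential

/-!
# Route PhotonSphereChannels — far (null-infinity side) asymptotics of the Regge–Wheeler potential

Helper file for the FAR half of `FixedModeChannels` (stmt-FinalStateConjecture-10048). In the tree's
normalisation of the tortoise radius function, `r x = efAreaRadius M (x − xc + r*(3M))`
(`tortoise_eq_efAreaRadius`), we record the elementary far-field comparison of the spin-`s`
Regge–Wheeler potential `V_{s,ℓ}(r) = (1 − 2M/r)(ℓ(ℓ+1)/r² + (1 − s²)·2M/r³)` with the EXACT
inverse-square potential `ℓ(ℓ+1)/y²` of the tortoise variable `y` (model coordinate, `r = efAreaRadius M y`):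

* `efAreaRadius_far_bounds`: for `y ≥ Y₀(M) := 64M² + 2M + 1`,
  `y − 2M log y ≤ efAreaRadius M y ≤ y` and `y/2 ≤ efAreaRadius M y`;
* `abs_rwPotential_efAreaRadius_sub_inverseSquare_le`: for `y ≥ Y₀(M)` and `s ≤ 2`,
  `|V_{s,ℓ}(efAreaRadius M y) − ℓ(ℓ+1)/y²| ≤ 16 M (ℓ(ℓ+1) + 3) (1 + log y) / y³`,
  i.e. the far perturbation `W = V − ℓ(ℓ+1)/y²` is `O(ℓ² M log y / y³)` — the size that makes the
  far channel a perturbation of the exact inverse-square (odd-dimensional radial) channel for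
  `ρ ≥ ρ_far(M, ℓ)` (`sup_{y > R + t} y|W(y)| ∈ L¹(dt)` with norm `O(ℓ² M log R / R)`);
* `rwPotential_efAreaRadius_le_far`: `V_{s,ℓ}(efAreaRadius M y) ≤ 4(ℓ(ℓ+1)+1)/y²` for `y ≥ Y₀(M)`;
* the same three statements for an arbitrary tortoise radius function `r` of the route's items
  (`2M < r`, `r' = 1 − 2M/r`, `r xc = 3M`), in the variable `y = x − x₀`,
  `x₀ := xc − efTortoiseCoord M (3M)` (`tortoise_far_bounds`,
  `abs_rwPotential_tortoise_sub_inverseSquare_le`, `rwPotential_tortoise_le_far`).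

No definitions; constants are explicit and crude.
-/

namespace Summit.FinalStateConjecture.FinalStateConjecture.Theorems

open Literature.Barriers.FinalStateConjecture Real Set

/-! ### A calculus fact -/

/-- For `y ≥ 64 M²` (`M > 0`, `y > 0`): `4M log y ≤ y` (via `log y = 2 log √y ≤ 2(√y − 1) < 2√y` and
`8M ≤ √y`). -/
theorem four_mul_mul_log_le {M : ℝ} (hM : 0 < M) {y : ℝ} (hy0 : 0 < y) (hy : 64 * M ^ 2 ≤ y) :
    4 * M * Real.log y ≤ y := by
  have hs : 0 ≤ Real.sqrt y := Real.sqrt_nonneg y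
  have hlog : Real.log y ≤ 2 * Real.sqrt y := by
    have h1 : Real.log y = 2 * Real.log (Real.sqrt y) := by
      rw [Real.log_sqrt hy0.le]; ring
    have h2 := Real.log_le_sub_one_of_pos (Real.sqrt_pos.mpr hy0)
    linarith
  have h8 : 8 * M ≤ Real.sqrt y := by
    rw [show (8 : ℝ) * M = Real.sqrt ((8 * M) ^ 2) by rw [Real.sqrt_sq (by positivity)]]
    exact Real.sqrt_le_sqrt (by nlinarith)
  calc 4 * M * Real.log y ≤ 4 * M * (2 * Real.sqrt y) :=
        mul_le_mul_of_nonneg_left hlog (by positivity)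
    _ = (8 * M) * Real.sqrt y := by ring
    _ ≤ Real.sqrt y * Real.sqrt y := mul_le_mul_of_nonneg_right h8 hs
    _ = y := Real.mul_self_sqrt hy0.le

/-! ### The model radius far out: `y − 2M log y ≤ r ≤ y`, `r ≥ y/2` -/

section Model

variable {M : ℝ}

/-- **Far comparison of the area radius with the tortoise coordinate (model).** For `M > 0` and
`y ≥ 64M² + 2M + 1`: `efAreaRadius M y ≤ y`, `y − 2M log y ≤ efAreaRadius M y`, `y/2 ≤ efAreaRadius M y`. -/
theorem efAreaRadius_far_bounds (hM : 0 < M) {y : ℝ} (hy : 64 * M ^ 2 + 2 * M + 1 ≤ y) :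
    efAreaRadius M y ≤ y ∧ y - 2 * M * Real.log y ≤ efAreaRadius M y ∧ y / 2 ≤ efAreaRadius M y := by
  have hM2 : 0 < 2 * M := by positivity
  have hy1 : 1 ≤ y := by nlinarith
  have hy0 : 0 < y := by linarith
  have hup : efAreaRadius M y ≤ y := by
    refine (efAreaRadius_le_max hM y).trans (max_le le_rfl ?_)
    nlinarith
  have hlow : y - 2 * M * Real.log y ≤ efAreaRadius M y := sub_log_le_efAreaRadius hM hy1
  refine ⟨hup, hlow, ?_⟩
  have h4 : 4 * M * Real.log y ≤ y := four_mul_mul_log_le hM hy0 (by nlinarith)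
  linarith

/-- **The Regge–Wheeler potential is inverse-square up to `O(ℓ² M log y / y³)` far out (model).**
For `M > 0`, `s ≤ 2`, any `ℓ`, and `y ≥ 64M² + 2M + 1`, with `r = efAreaRadius M y`:
`|(1 − 2M/r)(ℓ(ℓ+1)/r² + (1 − s²)2M/r³) − ℓ(ℓ+1)/y²| ≤ 16 M (ℓ(ℓ+1) + 3)(1 + log y)/y³`.
Proof: `|1/r² − 1/y²| = (y − r)(y + r)/(r²y²) ≤ 2M log y · 2y/((y/2)² y²)`, `2Mℓ(ℓ+1)/r³ ≤ 16Mℓ(ℓ+1)/y³`,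
`|1 − s²|·2M/r³ ≤ 48M/y³`. -/
theorem abs_rwPotential_efAreaRadius_sub_inverseSquare_le (hM : 0 < M) {s : ℕ} (hs : s ≤ 2) (ℓ : ℕ)
    {y : ℝ} (hy : 64 * M ^ 2 + 2 * M + 1 ≤ y) :
    |(1 - 2 * M / efAreaRadius M y) * ((ℓ : ℝ) * ((ℓ : ℝ) + 1) / efAreaRadius M y ^ 2
        + (1 - (s : ℝ) ^ 2) * (2 * M) / efAreaRadius M y ^ 3) - (ℓ : ℝ) * ((ℓ : ℝ) + 1) / y ^ 2|
      ≤ 16 * M * ((ℓ : ℝ) * ((ℓ : ℝ) + 1) + 3) * (1 + Real.log y) / y ^ 3 := by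
  obtain ⟨hup, hlow, hhalf⟩ := efAreaRadius_far_bounds hM hy
  set r := efAreaRadius M y with hr
  set L : ℝ := (ℓ : ℝ) * ((ℓ : ℝ) + 1) with hL
  have hL0 : 0 ≤ L := by positivity
  have hy1 : 1 ≤ y := by nlinarith
  have hy0 : 0 < y := by linarith
  have hr2 : 2 * M < r := two_mul_lt_efAreaRadius hM y
  have hr0 : 0 < r := lt_trans (by positivity) hr2
  have hlog0 : 0 ≤ Real.log y := Real.log_nonneg hy1
  have hd0 : 0 ≤ y - r := by linarith
  have hd : y - r ≤ 2 * M * Real.log y := by linarith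
  -- the redshift factor
  have hred0 : 0 ≤ 1 - 2 * M / r := by
    rw [sub_nonneg, div_le_one hr0]; exact hr2.le
  have hred1 : 1 - 2 * M / r ≤ 1 := by
    have : 0 ≤ 2 * M / r := by positivity
    linarith
  -- split `V − L/y²` into three pieces
  have hsplit : (1 - 2 * M / r) * (L / r ^ 2 + (1 - (s : ℝ) ^ 2) * (2 * M) / r ^ 3) - L / y ^ 2
      = L * (1 / r ^ 2 - 1 / y ^ 2) + (-(2 * M * L / r ^ 3))
        + (1 - 2 * M / r) * ((1 - (s : ℝ) ^ 2) * (2 * M) / r ^ 3) := by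
    field_simp
    ring
  -- piece 1
  have h1 : |L * (1 / r ^ 2 - 1 / y ^ 2)| ≤ 16 * M * L * Real.log y / y ^ 3 := by
    have hdiff0 : 0 ≤ 1 / r ^ 2 - 1 / y ^ 2 := by
      rw [sub_nonneg]
      exact one_div_le_one_div_of_le (by positivity) (pow_le_pow_left₀ hr0.le hup 2)
    rw [abs_of_nonneg (mul_nonneg hL0 hdiff0)]
    have hkey : 1 / r ^ 2 - 1 / y ^ 2 ≤ 16 * M * Real.log y / y ^ 3 := by
      rw [div_sub_div _ _ (by positivity) (by positivity), div_le_div_iff₀ (by positivity) (by positivity)]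
      -- (y² − r²)·y³ ≤ 16 M log y · (r² y²)
      have hfac : (1 * y ^ 2 - r ^ 2 * 1) = (y - r) * (y + r) := by ring
      rw [hfac]
      have hyr : y + r ≤ 2 * y := by linarith
      have hr2y : y ^ 2 ≤ 4 * r ^ 2 := by nlinarith
      have hA : (y - r) * (y + r) ≤ 2 * M * Real.log y * (2 * y) :=
        mul_le_mul hd hyr (by positivity) (by positivity)
      calc (y - r) * (y + r) * y ^ 3 ≤ 2 * M * Real.log y * (2 * y) * y ^ 3 :=
            mul_le_mul_of_nonneg_right hA (by positivity)
        _ = 4 * M * Real.log y * y ^ 2 * y ^ 2 := by ring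
        _ ≤ 4 * M * Real.log y * (4 * r ^ 2) * y ^ 2 := by gcongr
        _ = 16 * M * Real.log y * (r ^ 2 * y ^ 2) := by ring
    calc L * (1 / r ^ 2 - 1 / y ^ 2) ≤ L * (16 * M * Real.log y / y ^ 3) :=
          mul_le_mul_of_nonneg_left hkey hL0
      _ = 16 * M * L * Real.log y / y ^ 3 := by ring
  -- `1/r³ ≤ 8/y³`
  have hcube : 1 / r ^ 3 ≤ 8 / y ^ 3 := by
    rw [div_le_div_iff₀ (by positivity) (by positivity)]
    have : y ^ 3 ≤ (2 * r) ^ 3 := pow_le_pow_left₀ hy0.le (by linarith) 3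
    nlinarith
  -- piece 2
  have h2 : |-(2 * M * L / r ^ 3)| ≤ 16 * M * L / y ^ 3 := by
    rw [abs_neg, abs_of_nonneg (by positivity)]
    calc 2 * M * L / r ^ 3 = 2 * M * L * (1 / r ^ 3) := by ring
      _ ≤ 2 * M * L * (8 / y ^ 3) := mul_le_mul_of_nonneg_left hcube (by positivity)
      _ = 16 * M * L / y ^ 3 := by ring
  -- piece 3
  have h3 : |(1 - 2 * M / r) * ((1 - (s : ℝ) ^ 2) * (2 * M) / r ^ 3)| ≤ 48 * M / y ^ 3 := by
    have hs3 : |1 - (s : ℝ) ^ 2| ≤ 3 := by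
      interval_cases s <;> norm_num
    rw [abs_mul, abs_of_nonneg hred0]
    have hin : |(1 - (s : ℝ) ^ 2) * (2 * M) / r ^ 3| ≤ 3 * (2 * M) * (8 / y ^ 3) := by
      rw [abs_div, abs_mul, abs_of_nonneg (by positivity : (0 : ℝ) ≤ 2 * M),
        abs_of_nonneg (by positivity : (0 : ℝ) ≤ r ^ 3)]
      calc |1 - (s : ℝ) ^ 2| * (2 * M) / r ^ 3 = |1 - (s : ℝ) ^ 2| * (2 * M) * (1 / r ^ 3) := by ring
        _ ≤ 3 * (2 * M) * (8 / y ^ 3) :=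
            mul_le_mul (mul_le_mul_of_nonneg_right hs3 (by positivity)) hcube (by positivity)
              (by positivity)
    calc (1 - 2 * M / r) * |(1 - (s : ℝ) ^ 2) * (2 * M) / r ^ 3|
        ≤ 1 * (3 * (2 * M) * (8 / y ^ 3)) := mul_le_mul hred1 hin (abs_nonneg _) zero_le_one
      _ = 48 * M / y ^ 3 := by ring
  -- assemble
  show |(1 - 2 * M / r) * (L / r ^ 2 + (1 - (s : ℝ) ^ 2) * (2 * M) / r ^ 3) - L / y ^ 2|
      ≤ 16 * M * (L + 3) * (1 + Real.log y) / y ^ 3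
  rw [hsplit]
  refine ((abs_add_three _ _ _).trans (add_le_add (add_le_add h1 h2) h3)).trans ?_
  have hfin : 16 * M * L * Real.log y / y ^ 3 + 16 * M * L / y ^ 3 + 48 * M / y ^ 3
      = (16 * M * L * Real.log y + 16 * M * L + 48 * M) / y ^ 3 := by ring
  rw [hfin, div_le_div_iff_of_pos_right (by positivity)]
  nlinarith [mul_nonneg hM.le hlog0, mul_nonneg (mul_nonneg hM.le hL0) hlog0]

/-- **Crude far upper bound (model).** For `M > 0`, any `s, ℓ` and `y ≥ 64M² + 2M + 1`:
`V_{s,ℓ}(efAreaRadius M y) ≤ 4(ℓ(ℓ+1) + 1)/y²` (from `V ≤ (ℓ(ℓ+1)+1)/r²` and `r ≥ y/2`). -/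
theorem rwPotential_efAreaRadius_le_far (hM : 0 < M) (s ℓ : ℕ) {y : ℝ}
    (hy : 64 * M ^ 2 + 2 * M + 1 ≤ y) :
    (1 - 2 * M / efAreaRadius M y) * ((ℓ : ℝ) * ((ℓ : ℝ) + 1) / efAreaRadius M y ^ 2
        + (1 - (s : ℝ) ^ 2) * (2 * M) / efAreaRadius M y ^ 3)
      ≤ 4 * ((ℓ : ℝ) * ((ℓ : ℝ) + 1) + 1) / y ^ 2 := by
  obtain ⟨_, _, hhalf⟩ := efAreaRadius_far_bounds hM hy
  set r := efAreaRadius M y with hr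
  have hy0 : 0 < y := by nlinarith
  have hr2 : 2 * M < r := two_mul_lt_efAreaRadius hM y
  have hr0 : 0 < r := lt_trans (by positivity) hr2
  refine (rwPotential_le_div_sq (s := s) (ℓ := ℓ) hM hr2).trans ?_
  rw [div_le_div_iff₀ (by positivity) (by positivity)]
  have hL : 0 ≤ (ℓ : ℝ) * ((ℓ : ℝ) + 1) + 1 := by positivity
  have : y ^ 2 ≤ 4 * r ^ 2 := by nlinarith
  nlinarith [mul_le_mul_of_nonneg_left this hL]

end Model

/-! ### The same for an arbitrary tortoise radius function of the route's items -/

section Tortoise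

variable {M : ℝ} {r : ℝ → ℝ} {xc : ℝ}

/-- **Far comparison for any tortoise radius function.** Under `2M < r`, `r' = 1 − 2M/r`, `r xc = 3M`
(`M > 0`), with `x₀ := xc − efTortoiseCoord M (3M)`, for `x − x₀ ≥ 64M² + 2M + 1`:
`r x ≤ x − x₀`, `(x − x₀) − 2M log (x − x₀) ≤ r x`, `(x − x₀)/2 ≤ r x`. -/
theorem tortoise_far_bounds (hM : 0 < M) (hr : ∀ x, 2 * M < r x)
    (hr' : ∀ x, HasDerivAt r (1 - 2 * M / r x) x) (hxc : r xc = 3 * M) {x : ℝ}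
    (hx : 64 * M ^ 2 + 2 * M + 1 ≤ x - (xc - efTortoiseCoord M (3 * M))) :
    r x ≤ x - (xc - efTortoiseCoord M (3 * M))
      ∧ x - (xc - efTortoiseCoord M (3 * M)) - 2 * M * Real.log (x - (xc - efTortoiseCoord M (3 * M)))
          ≤ r x
      ∧ (x - (xc - efTortoiseCoord M (3 * M))) / 2 ≤ r x := by
  have heq : x - xc + efTortoiseCoord M (3 * M) = x - (xc - efTortoiseCoord M (3 * M)) := by ring
  rw [tortoise_eq_efAreaRadius hM hr hr' hxc x, heq]
  exact efAreaRadius_far_bounds hM hx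

/-- **The Regge–Wheeler potential of any tortoise radius function is inverse-square far out.**
Under the `r`-hypotheses, with `x₀ := xc − efTortoiseCoord M (3M)` and `y = x − x₀ ≥ 64M² + 2M + 1`,
`s ≤ 2`: `|V_{s,ℓ}(r x) − ℓ(ℓ+1)/y²| ≤ 16 M (ℓ(ℓ+1)+3)(1 + log y)/y³`. -/
theorem abs_rwPotential_tortoise_sub_inverseSquare_le (hM : 0 < M) (hr : ∀ x, 2 * M < r x)
    (hr' : ∀ x, HasDerivAt r (1 - 2 * M / r x) x) (hxc : r xc = 3 * M) {s : ℕ} (hs : s ≤ 2)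
    (ℓ : ℕ) {x : ℝ} (hx : 64 * M ^ 2 + 2 * M + 1 ≤ x - (xc - efTortoiseCoord M (3 * M))) :
    |(1 - 2 * M / r x) * ((ℓ : ℝ) * ((ℓ : ℝ) + 1) / r x ^ 2 + (1 - (s : ℝ) ^ 2) * (2 * M) / r x ^ 3)
        - (ℓ : ℝ) * ((ℓ : ℝ) + 1) / (x - (xc - efTortoiseCoord M (3 * M))) ^ 2|
      ≤ 16 * M * ((ℓ : ℝ) * ((ℓ : ℝ) + 1) + 3)
          * (1 + Real.log (x - (xc - efTortoiseCoord M (3 * M))))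
          / (x - (xc - efTortoiseCoord M (3 * M))) ^ 3 := by
  have heq : x - xc + efTortoiseCoord M (3 * M) = x - (xc - efTortoiseCoord M (3 * M)) := by ring
  rw [tortoise_eq_efAreaRadius hM hr hr' hxc x, heq]
  exact abs_rwPotential_efAreaRadius_sub_inverseSquare_le hM hs ℓ hx

/-- **Crude far upper bound for any tortoise radius function**: with `y = x − x₀ ≥ 64M² + 2M + 1`,
`V_{s,ℓ}(r x) ≤ 4(ℓ(ℓ+1)+1)/y²`. -/
theorem rwPotential_tortoise_le_far (hM : 0 < M) (hr : ∀ x, 2 * M < r x)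
    (hr' : ∀ x, HasDerivAt r (1 - 2 * M / r x) x) (hxc : r xc = 3 * M) (s ℓ : ℕ) {x : ℝ}
    (hx : 64 * M ^ 2 + 2 * M + 1 ≤ x - (xc - efTortoiseCoord M (3 * M))) :
    (1 - 2 * M / r x) * ((ℓ : ℝ) * ((ℓ : ℝ) + 1) / r x ^ 2 + (1 - (s : ℝ) ^ 2) * (2 * M) / r x ^ 3)
      ≤ 4 * ((ℓ : ℝ) * ((ℓ : ℝ) + 1) + 1) / (x - (xc - efTortoiseCoord M (3 * M))) ^ 2 := by
  have heq : x - xc + efTortoiseCoord M (3 * M) = x - (xc - efTortoiseCoord M (3 * M)) := by ring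
  rw [tortoise_eq_efAreaRadius hM hr hr' hxc x, heq]
  exact rwPotential_efAreaRadius_le_far hM s ℓ hx

end Tortoise

end Summit.FinalStateConjecture.FinalStateConjecture.Theorems
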